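import Summits.QuantumFields.YangMills.Theses.LangevinControlUV

/-!
# Route `LangevinControlUV`, crux `FemtoCurvatureTwoPointC` (stmt-QuantumFields-16204): vocabulary of line `Sketch`

Route-posited statements (D-0016 `<Route><Crux>Defs` file) of the registered skeleton
`Cruxes/FemtoCurvatureTwoPointC/Lines/Sketch.lean` (lead `prover-line-stmt-QuantumFields-16204-0`): the crux body at
fixed data `CruxCAt r` (verbatim; `femtoCurvatureTwoPointC_iff` is `Iff.rfl` up to bundling) and the line's ONE physics
statement `AFCouplingAt r` — an admissible finite-volume coupling obeying the asymptotic-freedom step law, matched per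
datum to the curvature two-point function — whose universal closure `AFCoupling` is, character for character, the
registered stub `stub_afCoupling` (`afCoupling_iff_stub : AFCoupling ↔ … := Iff.rfl`).

NOTHING here is asserted: `AFCouplingAt` / `AFCoupling` are line statements (open; the femto continuum limit with
observables in step-scaling form), consumed by the reduction `cruxCAt_of_afCouplingAt` (companion file
`…FemtoCurvatureTwoPointCReduction.lean`, which uses the landed real-analysis stubs `stub_unitMap`,
`stub_packageOfUnitMap`). None is a literature fact; none restates the crux as a claim.

Refs: cards `Cruxes/FemtoCurvatureTwoPointC/Ideas/intrinsic-coupling-encoding.md` (ideator 1: admissible coupling,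
AF step inequality, axis/pair matching) and `…/ir-anchored-octave-law.md` (ideator 2: IR anchor, octave law);
`Cruxes/FemtoCurvatureTwoPointC/PICKED.md`; predecessor dissection `Cruxes/FemtoCurvatureTwoPoint/Disproof.lean` § Repairs
(`rg_chain_of_continuous`: why continuity of the unit map makes asymptotic freedom load-bearing).
-/

set_option autoImplicit false

noncomputable section

open Filter Topology MeasureTheory
open Literature.MathematicalPhysics.QuantumFieldTheory

namespace Summit.QuantumFields.YangMills.Theorems.FemtoCurvatureTwoPointC

/-- **The crux body at fixed data `(G, r)`** (verbatim the body of
`Summit.QuantumFields.YangMills.Theses.LangevinControlUV.FemtoCurvatureTwoPointC` after `∀ r`, for an arbitrary Borel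
structure on `G`): a CONTINUOUS unit map `a > 0`, `a → 0`, a shape `Γ ∈ (0,1]` on `(0, ℓ₀]` and constants such that on
every femto torus (`β ≥ β₀`, `L·a β ≤ ℓ₀`) the axis covariances `n⁸·Cov(P_0^{01}, P_{ne₂}^{01})` are two-sidedly
`≍ Γ(n·a β)` for `1 ≤ n ≤ L/8` and every pair covariance obeys `|Cov|·dist⁸ ≤ C·Γ(dist·a β)`. -/
def CruxCAt {G : Type} [Group G] [TopologicalSpace G] [IsTopologicalGroup G] [CompactSpace G]
    [MeasurableSpace G] [BorelSpace G] (r : LatticeRep G) : Prop :=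
  ∃ (a : ℝ → ℝ), Continuous a ∧ ∃ (Γ : ℝ → ℝ) (β₀ ℓ₀ c C : ℝ), 0 < ℓ₀ ∧ 0 < c ∧ (∀ β, 0 < a β) ∧
    Filter.Tendsto a Filter.atTop (nhds 0) ∧ (∀ s : ℝ, 0 < s → s ≤ ℓ₀ → 0 < Γ s ∧ Γ s ≤ 1) ∧
    ∀ (L : ℕ) [NeZero L] (β : ℝ), β₀ ≤ β → (L : ℝ) * a β ≤ ℓ₀ →
      let P : (Fin 4 → ZMod L) → Fin 4 → Fin 4 → GaugeConfig 4 L G → ℝ :=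
        fun x i j U => (r.N : ℝ) - (r.ρ (plaquetteHolonomy U x i j)).trace.re
      let E : (GaugeConfig 4 L G → ℝ) → ℝ := fun F => wilsonExpectation (d := 4) (L := L) r.ρ β F
      let cov : (GaugeConfig 4 L G → ℝ) → (GaugeConfig 4 L G → ℝ) → ℝ :=
        fun F F' => E (fun U => F U * F' U) - E F * E F'
      let dist : (Fin 4 → ZMod L) → (Fin 4 → ZMod L) → ℝ :=
        fun x y => Real.sqrt (∑ k : Fin 4, (((x k - y k).valMinAbs : ℤ) : ℝ) ^ 2)
      (∀ n : ℕ, 1 ≤ n → 8 * n ≤ L →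
          c * Γ ((n : ℝ) * a β) ≤ (n : ℝ) ^ 8 * cov (P 0 0 1) (P (Pi.single (2 : Fin 4) ((n : ℕ) : ZMod L)) 0 1) ∧
          (n : ℝ) ^ 8 * cov (P 0 0 1) (P (Pi.single (2 : Fin 4) ((n : ℕ) : ZMod L)) 0 1) ≤ C * Γ ((n : ℝ) * a β)) ∧
      (∀ (x y : Fin 4 → ZMod L) (i j i' j' : Fin 4), x ≠ y → i ≠ j → i' ≠ j' →
          |cov (P x i j) (P y i' j')| * dist x y ^ 8 ≤ C * Γ (dist x y * a β))

/-- Definitional unbundling of the crux: `FemtoCurvatureTwoPointC ↔ ∀ G compact simple, ∀ r, CruxCAt r` (with the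
Borel σ-algebra `borel G`). -/
theorem femtoCurvatureTwoPointC_iff :
    Summit.QuantumFields.YangMills.Theses.LangevinControlUV.FemtoCurvatureTwoPointC ↔
      ∀ (G : Type) [Group G] [TopologicalSpace G] [IsTopologicalGroup G] [CompactSpace G],
        IsCompactSimpleLieGroup G →
          letI : MeasurableSpace G := borel G
          haveI : BorelSpace G := ⟨rfl⟩
          ∀ r : LatticeRep G, CruxCAt r :=
  Iff.rfl

/-- **AF coupling at fixed data `(G, r)` — the line's physics statement (OPEN; crux-sized).** There are a
finite-volume coupling `u L β` (box side `L`, bare coupling `β`) and constants `u₀, c, κ₁ > 0`, `κ₃ ≥ 0`, `β₀, κ₂, C`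
with: ADMISSIBILITY — `u L β > 0`, `β ↦ u L β` continuous on `[β₀, ∞)` and `→ 0` as `β → ∞` (freezing), for every box
`L ≥ 8`; IN-WINDOW COMPARABILITY — `|1/u(L,β) − 1/u(L',β)| ≤ κ₂` for `8 ≤ L ≤ L' ≤ 2L` when every sub-box
`8 ≤ M ≤ L` has `u M β ≤ u₀` ("box `L` in the window"); the averaged two-sided dyadic ASYMPTOTIC-FREEDOM STEP LAW —
`κ₁ m − κ₃ ≤ 1/u(8·2ᵏ,β) − 1/u(8·2ᵏ⁺ᵐ,β) ≤ κ₂ m + κ₃` when box `8·2ᵏ⁺ᵐ` is in the window (`κ₁ > 0` is the running;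
it fails for compact `U(1)`); AXIS MATCHING — `c·u(8n,β)² ≤ n⁸·Cov_{L,β}(P_0^{01},P_{ne₂}^{01}) ≤ C·u(8n,β)²` for
`1 ≤ n`, `8n ≤ L`, box `L` in the window; PAIR MATCHING —
`|Cov_{L,β}(P_x^{ij},P_y^{i'j'})|·dist(x,y)⁸ ≤ C·u(max 8 (min L (8⌈dist⌉)),β)²` for `x ≠ y` on every window box
(vacuous window condition on `L < 8`). Intended instances of `u`: the tree-normalised curvature scheme
`û = √(θ_L/A)` (card ir-anchored-octave-law) or a gradient-flow scheme (`wilsonFlow`). Content: Bałaban-class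
ultraviolet stability WITH an observable along femto trajectories — not in print for any 4-D non-abelian lattice
gauge theory. -/
def AFCouplingAt {G : Type} [Group G] [TopologicalSpace G] [IsTopologicalGroup G] [CompactSpace G]
    [MeasurableSpace G] [BorelSpace G] (r : LatticeRep G) : Prop :=
  ∃ (u : ℕ → ℝ → ℝ) (u₀ β₀ κ₁ κ₂ κ₃ c C : ℝ),
    0 < u₀ ∧ 0 < c ∧ 0 < κ₁ ∧ 0 ≤ κ₃ ∧
    (∀ (L : ℕ) (β : ℝ), 8 ≤ L → β₀ ≤ β → 0 < u L β) ∧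
    (∀ L : ℕ, 8 ≤ L → ContinuousOn (u L) (Set.Ici β₀)) ∧
    (∀ L : ℕ, 8 ≤ L → Filter.Tendsto (u L) Filter.atTop (nhds 0)) ∧
    (∀ (L L' : ℕ) (β : ℝ), β₀ ≤ β → 8 ≤ L → L ≤ L' → L' ≤ 2 * L →
        (∀ M : ℕ, 8 ≤ M → M ≤ L → u M β ≤ u₀) → |(u L β)⁻¹ - (u L' β)⁻¹| ≤ κ₂) ∧
    (∀ (k m : ℕ) (β : ℝ), β₀ ≤ β → (∀ M : ℕ, 8 ≤ M → M ≤ 8 * 2 ^ (k + m) → u M β ≤ u₀) →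
        κ₁ * m - κ₃ ≤ (u (8 * 2 ^ k) β)⁻¹ - (u (8 * 2 ^ (k + m)) β)⁻¹ ∧
          (u (8 * 2 ^ k) β)⁻¹ - (u (8 * 2 ^ (k + m)) β)⁻¹ ≤ κ₂ * m + κ₃) ∧
    (∀ (L : ℕ) [NeZero L] (β : ℝ) (n : ℕ), β₀ ≤ β → 1 ≤ n → 8 * n ≤ L →
        (∀ M : ℕ, 8 ≤ M → M ≤ L → u M β ≤ u₀) →
        ∀ (P : (Fin 4 → ZMod L) → Fin 4 → Fin 4 → GaugeConfig 4 L G → ℝ)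
          (E : (GaugeConfig 4 L G → ℝ) → ℝ),
          (P = fun x i j U => (r.N : ℝ) - (r.ρ (plaquetteHolonomy U x i j)).trace.re) →
          (E = fun F => wilsonExpectation r.ρ β F) →
          c * u (8 * n) β ^ 2 ≤
              (n : ℝ) ^ 8 * (E (fun U => P 0 0 1 U * P (Pi.single (2 : Fin 4) ((n : ℕ) : ZMod L)) 0 1 U)
                - E (P 0 0 1) * E (P (Pi.single (2 : Fin 4) ((n : ℕ) : ZMod L)) 0 1)) ∧
            (n : ℝ) ^ 8 * (E (fun U => P 0 0 1 U * P (Pi.single (2 : Fin 4) ((n : ℕ) : ZMod L)) 0 1 U)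
                - E (P 0 0 1) * E (P (Pi.single (2 : Fin 4) ((n : ℕ) : ZMod L)) 0 1)) ≤
              C * u (8 * n) β ^ 2) ∧
    (∀ (L : ℕ) [NeZero L] (β : ℝ), β₀ ≤ β → (∀ M : ℕ, 8 ≤ M → M ≤ L → u M β ≤ u₀) →
        ∀ (P : (Fin 4 → ZMod L) → Fin 4 → Fin 4 → GaugeConfig 4 L G → ℝ)
          (E : (GaugeConfig 4 L G → ℝ) → ℝ),
          (P = fun x i j U => (r.N : ℝ) - (r.ρ (plaquetteHolonomy U x i j)).trace.re) →
          (E = fun F => wilsonExpectation r.ρ β F) →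
          ∀ (x y : Fin 4 → ZMod L) (i j i' j' : Fin 4), x ≠ y → i ≠ j → i' ≠ j' →
            |E (fun U => P x i j U * P y i' j' U) - E (P x i j) * E (P y i' j')| *
                Real.sqrt (∑ k : Fin 4, (((x k - y k).valMinAbs : ℤ) : ℝ) ^ 2) ^ 8 ≤
              C * u (max 8 (min L (8 * ⌈Real.sqrt (∑ k : Fin 4, (((x k - y k).valMinAbs : ℤ) : ℝ) ^ 2)⌉₊)))
                β ^ 2)

/-- **AF coupling (universal closure): for every compact simple `G` (any Borel structure) and faithful unitary `r`,
`AFCouplingAt r`.** This is the registered stub `stub_afCoupling` of line `Sketch`, by name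
(`afCoupling_iff_stub`). OPEN. -/
def AFCoupling : Prop :=
  ∀ (G : Type) [Group G] [TopologicalSpace G] [IsTopologicalGroup G] [CompactSpace G]
    [MeasurableSpace G] [BorelSpace G], IsCompactSimpleLieGroup G →
    ∀ r : LatticeRep G, AFCouplingAt r

/-- `AFCoupling` is, definitionally, the registered stub signature of `stub_afCoupling` (line `Sketch`, crux
stmt-QuantumFields-16204) — so a proof of that stub is a proof of `AFCoupling` and conversely. -/
theorem afCoupling_iff_stub :
    AFCoupling ↔
      ∀ (G : Type) [Group G] [TopologicalSpace G] [IsTopologicalGroup G] [CompactSpace G]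
        [MeasurableSpace G] [BorelSpace G], IsCompactSimpleLieGroup G →
        ∀ r : LatticeRep G, ∃ (u : ℕ → ℝ → ℝ) (u₀ β₀ κ₁ κ₂ κ₃ c C : ℝ),
          0 < u₀ ∧ 0 < c ∧ 0 < κ₁ ∧ 0 ≤ κ₃ ∧
          (∀ (L : ℕ) (β : ℝ), 8 ≤ L → β₀ ≤ β → 0 < u L β) ∧
          (∀ L : ℕ, 8 ≤ L → ContinuousOn (u L) (Set.Ici β₀)) ∧
          (∀ L : ℕ, 8 ≤ L → Filter.Tendsto (u L) Filter.atTop (nhds 0)) ∧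
          (∀ (L L' : ℕ) (β : ℝ), β₀ ≤ β → 8 ≤ L → L ≤ L' → L' ≤ 2 * L →
              (∀ M : ℕ, 8 ≤ M → M ≤ L → u M β ≤ u₀) → |(u L β)⁻¹ - (u L' β)⁻¹| ≤ κ₂) ∧
          (∀ (k m : ℕ) (β : ℝ), β₀ ≤ β → (∀ M : ℕ, 8 ≤ M → M ≤ 8 * 2 ^ (k + m) → u M β ≤ u₀) →
              κ₁ * m - κ₃ ≤ (u (8 * 2 ^ k) β)⁻¹ - (u (8 * 2 ^ (k + m)) β)⁻¹ ∧
                (u (8 * 2 ^ k) β)⁻¹ - (u (8 * 2 ^ (k + m)) β)⁻¹ ≤ κ₂ * m + κ₃) ∧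
          (∀ (L : ℕ) [NeZero L] (β : ℝ) (n : ℕ), β₀ ≤ β → 1 ≤ n → 8 * n ≤ L →
              (∀ M : ℕ, 8 ≤ M → M ≤ L → u M β ≤ u₀) →
              ∀ (P : (Fin 4 → ZMod L) → Fin 4 → Fin 4 → GaugeConfig 4 L G → ℝ)
                (E : (GaugeConfig 4 L G → ℝ) → ℝ),
                (P = fun x i j U => (r.N : ℝ) - (r.ρ (plaquetteHolonomy U x i j)).trace.re) →
                (E = fun F => wilsonExpectation r.ρ β F) →
                c * u (8 * n) β ^ 2 ≤
                    (n : ℝ) ^ 8 * (E (fun U => P 0 0 1 U * P (Pi.single (2 : Fin 4) ((n : ℕ) : ZMod L)) 0 1 U)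
                      - E (P 0 0 1) * E (P (Pi.single (2 : Fin 4) ((n : ℕ) : ZMod L)) 0 1)) ∧
                  (n : ℝ) ^ 8 * (E (fun U => P 0 0 1 U * P (Pi.single (2 : Fin 4) ((n : ℕ) : ZMod L)) 0 1 U)
                      - E (P 0 0 1) * E (P (Pi.single (2 : Fin 4) ((n : ℕ) : ZMod L)) 0 1)) ≤
                    C * u (8 * n) β ^ 2) ∧
          (∀ (L : ℕ) [NeZero L] (β : ℝ), β₀ ≤ β → (∀ M : ℕ, 8 ≤ M → M ≤ L → u M β ≤ u₀) →
              ∀ (P : (Fin 4 → ZMod L) → Fin 4 → Fin 4 → GaugeConfig 4 L G → ℝ)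
                (E : (GaugeConfig 4 L G → ℝ) → ℝ),
                (P = fun x i j U => (r.N : ℝ) - (r.ρ (plaquetteHolonomy U x i j)).trace.re) →
                (E = fun F => wilsonExpectation r.ρ β F) →
                ∀ (x y : Fin 4 → ZMod L) (i j i' j' : Fin 4), x ≠ y → i ≠ j → i' ≠ j' →
                  |E (fun U => P x i j U * P y i' j' U) - E (P x i j) * E (P y i' j')| *
                      Real.sqrt (∑ k : Fin 4, (((x k - y k).valMinAbs : ℤ) : ℝ) ^ 2) ^ 8 ≤
                    C * u (max 8 (min L (8 * ⌈Real.sqrt (∑ k : Fin 4, (((x k - y k).valMinAbs : ℤ) : ℝ) ^ 2)⌉₊)))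
                      β ^ 2) :=
  Iff.rfl

/-! ## Cycle 2 (lead reshape): the explicit two-loop asymptotic-freedom coupling and the physics statement
`AsymptoticScalingAt` (registered stub `stub_asymptoticScaling` of `Cruxes/FemtoCurvatureTwoPointC/Lines/Sketch.lean`, v2) -/

/-- **Two-loop inverse-coupling profile** `ψ_q(t) = (1+q)·e^{min(t,0)} + max(t,0) + q·(log(max(t,0) + e) − 1)`: for `t ≥ 0`
this is `1 + t + q·log(t + e)` (the large-`t` inverse of the exact two-loop RG invariant `Φ_q(y) = y − q·log(y+q)` up to
`O(1)`), for `t < 0` it is `(1+q)·eᵗ`; positive, continuous and non-decreasing for `q ≥ 0`. -/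
def twoLoopPsi (q t : ℝ) : ℝ :=
  (1 + q) * Real.exp (min t 0) + max t 0 + q * (Real.log (max t 0 + Real.exp 1) - 1)

/-- **Two-loop RG time of the box `L` at bare coupling `β`**: `T(L,β) = y − q·log(y + q) − 2b₀·log(L/8)` with
`y = max(κβ + c₀, 1)` (`κβ + c₀ = 1/g₀²` in the representation's normalisation; `b₀` the one-loop coefficient in the
convention `d(1/g²)/d log L = −2b₀ − 2b₁g²`; `q = b₁/b₀`). -/
def twoLoopT (κ c₀ b₀ q : ℝ) : ℕ → ℝ → ℝ := fun L β =>
  max (κ * β + c₀) 1 - q * Real.log (max (κ * β + c₀) 1 + q) - 2 * b₀ * Real.log ((L : ℝ) / 8)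

/-- **The explicit two-loop asymptotic-freedom coupling** `u(L,β) = ψ_q(T(L,β))⁻¹` of line `Sketch`, cycle 2 — the witness
that instantiates the existential coupling of `AFCouplingAt`: its admissibility, in-window comparability and two-sided dyadic
step law (`κ₁ = 2b₀ log 2`, `κ₂ = 2b₀ log 2·(1+q)`, `κ₃ = 0`) are the landed calculus stubs `stub_twoLoopAdmissible`
(`…CStubTwoLoopAdmissible`) and `stub_twoLoopStepLaw` (`…CStubTwoLoopStepLaw`). -/
def twoLoopCoupling (κ c₀ b₀ q : ℝ) : ℕ → ℝ → ℝ := fun L β => (twoLoopPsi q (twoLoopT κ c₀ b₀ q L β))⁻¹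

/-- **Asymptotic scaling at fixed data `(G, r)` — the line's physics statement after cycle 2 (OPEN; crux-sized).** There
are two-loop parameters `κ > 0`, `c₀`, `b₀ > 0` (asymptotic freedom), `q ≥ 0`, a window height `u₀ > 0` with
`u₀·ψ_q(2b₀ log 2) < 1`, a threshold `β₀` and constants `0 < c`, `C` such that, `u` denoting the explicit two-loop coupling
(`T = twoLoopT κ c₀ b₀ q`, `u L β = (twoLoopPsi q (T L β))⁻¹`), on every box `L` in the `u`-window at `β ≥ β₀` (every
sub-box `8 ≤ M ≤ L` has `u M β ≤ u₀`, i.e. `L ≤ ℓ·a₂ₗₒₒₚ(β)⁻¹`): AXIS MATCHING `c·u(8n,β)² ≤ n⁸·Cov_{L,β}(P_0^{01},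
P_{ne₂}^{01}) ≤ C·u(8n,β)²` (`1 ≤ n`, `8n ≤ L`) and PAIR DOMINATION `|Cov_{L,β}(P_x^{ij},P_y^{i'j'})|·dist(x,y)⁸ ≤
C·u(max 8 (min L (8⌈dist⌉)),β)²` (`x ≠ y`). Two-sided asymptotic scaling of the curvature two-point function in the femto
universe in explicit two-loop units (multiplicative: lattice artefacts, finite-size and toron factors, three-loop running are
bounded factors). Clauses written exactly as in `AFCouplingAt` (same `P`, `E` equations). -/
def AsymptoticScalingAt {G : Type} [Group G] [TopologicalSpace G] [IsTopologicalGroup G] [CompactSpace G]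
    [MeasurableSpace G] [BorelSpace G] (r : LatticeRep G) : Prop :=
  ∃ (κ c₀ b₀ q u₀ β₀ c C : ℝ),
    0 < κ ∧ 0 < b₀ ∧ 0 ≤ q ∧ 0 < u₀ ∧
    u₀ * (1 + 2 * b₀ * Real.log 2 + q * Real.log (2 * b₀ * Real.log 2 + Real.exp 1)) < 1 ∧ 0 < c ∧
    ∀ (T u : ℕ → ℝ → ℝ),
      (T = fun (L : ℕ) (β : ℝ) => max (κ * β + c₀) 1 - q * Real.log (max (κ * β + c₀) 1 + q) -
          2 * b₀ * Real.log ((L : ℝ) / 8)) →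
      (u = fun (L : ℕ) (β : ℝ) => ((1 + q) * Real.exp (min (T L β) 0) + max (T L β) 0 +
          q * (Real.log (max (T L β) 0 + Real.exp 1) - 1))⁻¹) →
      (∀ (L : ℕ) [NeZero L] (β : ℝ) (n : ℕ), β₀ ≤ β → 1 ≤ n → 8 * n ≤ L →
          (∀ M : ℕ, 8 ≤ M → M ≤ L → u M β ≤ u₀) →
          ∀ (P : (Fin 4 → ZMod L) → Fin 4 → Fin 4 → GaugeConfig 4 L G → ℝ)
            (E : (GaugeConfig 4 L G → ℝ) → ℝ),
            (P = fun x i j U => (r.N : ℝ) - (r.ρ (plaquetteHolonomy U x i j)).trace.re) →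
            (E = fun F => wilsonExpectation r.ρ β F) →
            c * u (8 * n) β ^ 2 ≤
                (n : ℝ) ^ 8 * (E (fun U => P 0 0 1 U * P (Pi.single (2 : Fin 4) ((n : ℕ) : ZMod L)) 0 1 U)
                  - E (P 0 0 1) * E (P (Pi.single (2 : Fin 4) ((n : ℕ) : ZMod L)) 0 1)) ∧
              (n : ℝ) ^ 8 * (E (fun U => P 0 0 1 U * P (Pi.single (2 : Fin 4) ((n : ℕ) : ZMod L)) 0 1 U)
                  - E (P 0 0 1) * E (P (Pi.single (2 : Fin 4) ((n : ℕ) : ZMod L)) 0 1)) ≤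
                C * u (8 * n) β ^ 2) ∧
      (∀ (L : ℕ) [NeZero L] (β : ℝ), β₀ ≤ β → (∀ M : ℕ, 8 ≤ M → M ≤ L → u M β ≤ u₀) →
          ∀ (P : (Fin 4 → ZMod L) → Fin 4 → Fin 4 → GaugeConfig 4 L G → ℝ)
            (E : (GaugeConfig 4 L G → ℝ) → ℝ),
            (P = fun x i j U => (r.N : ℝ) - (r.ρ (plaquetteHolonomy U x i j)).trace.re) →
            (E = fun F => wilsonExpectation r.ρ β F) →
            ∀ (x y : Fin 4 → ZMod L) (i j i' j' : Fin 4), x ≠ y → i ≠ j → i' ≠ j' →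
              |E (fun U => P x i j U * P y i' j' U) - E (P x i j) * E (P y i' j')| *
                  Real.sqrt (∑ k : Fin 4, (((x k - y k).valMinAbs : ℤ) : ℝ) ^ 2) ^ 8 ≤
                C * u (max 8 (min L (8 * ⌈Real.sqrt (∑ k : Fin 4, (((x k - y k).valMinAbs : ℤ) : ℝ) ^ 2)⌉₊)))
                  β ^ 2)

/-- **Asymptotic scaling (universal closure)**: for every compact simple `G` (any Borel structure) and faithful unitary `r`,
`AsymptoticScalingAt r`. This is, character for character, the registered stub `stub_asymptoticScaling` of line `Sketch`
(skeleton v2) — `asymptoticScaling_iff_stub`. OPEN (the femto continuum limit with a dimension-8 observable; not in print). -/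
def AsymptoticScaling : Prop :=
  ∀ (G : Type) [Group G] [TopologicalSpace G] [IsTopologicalGroup G] [CompactSpace G]
    [MeasurableSpace G] [BorelSpace G], IsCompactSimpleLieGroup G →
    ∀ r : LatticeRep G, AsymptoticScalingAt r

/-- The `T`/`u` equations of `AsymptoticScalingAt` say `T = twoLoopT κ c₀ b₀ q` and `u = twoLoopCoupling κ c₀ b₀ q`
(definitional unfolding). -/
theorem twoLoopCoupling_eq (κ c₀ b₀ q : ℝ) :
    twoLoopCoupling κ c₀ b₀ q = fun (L : ℕ) (β : ℝ) =>
      ((1 + q) * Real.exp (min (twoLoopT κ c₀ b₀ q L β) 0) + max (twoLoopT κ c₀ b₀ q L β) 0 +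
        q * (Real.log (max (twoLoopT κ c₀ b₀ q L β) 0 + Real.exp 1) - 1))⁻¹ :=
  rfl

/-- `twoLoopT` unfolded (definitional). -/
theorem twoLoopT_eq (κ c₀ b₀ q : ℝ) :
    twoLoopT κ c₀ b₀ q = fun (L : ℕ) (β : ℝ) =>
      max (κ * β + c₀) 1 - q * Real.log (max (κ * β + c₀) 1 + q) - 2 * b₀ * Real.log ((L : ℝ) / 8) :=
  rfl

/-- `AsymptoticScaling` is, definitionally, the registered stub signature of `stub_asymptoticScaling` (line `Sketch`,
skeleton v2, crux stmt-QuantumFields-16204) — so a proof of that stub is a proof of `AsymptoticScaling` and conversely. -/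
theorem asymptoticScaling_iff_stub :
    AsymptoticScaling ↔
      ∀ (G : Type) [Group G] [TopologicalSpace G] [IsTopologicalGroup G] [CompactSpace G]
        [MeasurableSpace G] [BorelSpace G], IsCompactSimpleLieGroup G →
        ∀ r : LatticeRep G,
        ∃ (κ c₀ b₀ q u₀ β₀ c C : ℝ),
          0 < κ ∧ 0 < b₀ ∧ 0 ≤ q ∧ 0 < u₀ ∧
          u₀ * (1 + 2 * b₀ * Real.log 2 + q * Real.log (2 * b₀ * Real.log 2 + Real.exp 1)) < 1 ∧ 0 < c ∧
          ∀ (T u : ℕ → ℝ → ℝ),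
            (T = fun (L : ℕ) (β : ℝ) => max (κ * β + c₀) 1 - q * Real.log (max (κ * β + c₀) 1 + q) -
                2 * b₀ * Real.log ((L : ℝ) / 8)) →
            (u = fun (L : ℕ) (β : ℝ) => ((1 + q) * Real.exp (min (T L β) 0) + max (T L β) 0 +
                q * (Real.log (max (T L β) 0 + Real.exp 1) - 1))⁻¹) →
            (∀ (L : ℕ) [NeZero L] (β : ℝ) (n : ℕ), β₀ ≤ β → 1 ≤ n → 8 * n ≤ L →
                (∀ M : ℕ, 8 ≤ M → M ≤ L → u M β ≤ u₀) →
                ∀ (P : (Fin 4 → ZMod L) → Fin 4 → Fin 4 → GaugeConfig 4 L G → ℝ)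
                  (E : (GaugeConfig 4 L G → ℝ) → ℝ),
                  (P = fun x i j U => (r.N : ℝ) - (r.ρ (plaquetteHolonomy U x i j)).trace.re) →
                  (E = fun F => wilsonExpectation r.ρ β F) →
                  c * u (8 * n) β ^ 2 ≤
                      (n : ℝ) ^ 8 * (E (fun U => P 0 0 1 U * P (Pi.single (2 : Fin 4) ((n : ℕ) : ZMod L)) 0 1 U)
                        - E (P 0 0 1) * E (P (Pi.single (2 : Fin 4) ((n : ℕ) : ZMod L)) 0 1)) ∧
                    (n : ℝ) ^ 8 * (E (fun U => P 0 0 1 U * P (Pi.single (2 : Fin 4) ((n : ℕ) : ZMod L)) 0 1 U)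
                        - E (P 0 0 1) * E (P (Pi.single (2 : Fin 4) ((n : ℕ) : ZMod L)) 0 1)) ≤
                      C * u (8 * n) β ^ 2) ∧
            (∀ (L : ℕ) [NeZero L] (β : ℝ), β₀ ≤ β → (∀ M : ℕ, 8 ≤ M → M ≤ L → u M β ≤ u₀) →
                ∀ (P : (Fin 4 → ZMod L) → Fin 4 → Fin 4 → GaugeConfig 4 L G → ℝ)
                  (E : (GaugeConfig 4 L G → ℝ) → ℝ),
                  (P = fun x i j U => (r.N : ℝ) - (r.ρ (plaquetteHolonomy U x i j)).trace.re) →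
                  (E = fun F => wilsonExpectation r.ρ β F) →
                  ∀ (x y : Fin 4 → ZMod L) (i j i' j' : Fin 4), x ≠ y → i ≠ j → i' ≠ j' →
                    |E (fun U => P x i j U * P y i' j' U) - E (P x i j) * E (P y i' j')| *
                        Real.sqrt (∑ k : Fin 4, (((x k - y k).valMinAbs : ℤ) : ℝ) ^ 2) ^ 8 ≤
                      C * u (max 8 (min L (8 * ⌈Real.sqrt (∑ k : Fin 4, (((x k - y k).valMinAbs : ℤ) : ℝ) ^ 2)⌉₊)))
                        β ^ 2) :=
  Iff.rfl

end Summit.QuantumFields.YangMills.Theorems.FemtoCurvatureTwoPointC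

end
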